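import Mathlib
import Summits.Ventures.HodgeRepro2.Tier7.Target

/-!
# Tier7/Line2/Eps — the splitting `ℂ ⊗_ℚ K ≅ ∏_σ ℂ` (LEMMA 6 `exists_eps` of `Tier7/Line2/Galois.lean`)

Filer: t7-L1-p3 (gen 2, prover-pub-hodge-repro2-t7-L1-p3-g2-0), on plan-2's lemma cut
`route/t7/Line2/GALOIS-LEMMAS.md` item 6 and the TARGET line STATUS l. 14972. Lane: SUPPORT for the Line-2
Galois-transport module (itself support for Line 3's residual); NOT a line, NOT a device; the lemma serves only
the (A′) pre-emption instance `rationalStructure_of_squareZero` (lemma 7).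

STATEMENT. For a number field `K` there is a family `eps : (K →+* ℂ) → ℂ ⊗[ℚ] K` of σ-idempotents with
`(1 ⊗ x) · ε_σ = σ(x) · ε_σ`, `ε_σ ≠ 0`, `∑_σ ε_σ = 1`, every σ-eigenvector a multiple of `ε_σ`, and
`ε̄_σ = ε_{σ̄}` (conjugation on the coefficient). This is the textbook splitting `K ⊗_ℚ ℂ ≅ ∏_{σ : K → ℂ} ℂ`
for the separable extension `K/ℚ` (Bourbaki, Algèbre V §6 no 7); here it is PROVED from Mathlib, not displayed.

PROOF. `split : ℂ ⊗[ℚ] K →ₐ[ℂ] ((K →+* ℂ) → ℂ)`, `c ⊗ x ↦ (σ ↦ c · σ x)` (`AlgHom.liftEquiv`). For `σ ≠ τ` pick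
`x_{στ} ∈ K` with `σ x ≠ τ x` and put `ε_σ := ∏_{τ ≠ σ} (σ x_{στ} - τ x_{στ})⁻¹ • ((1 ⊗ x_{στ}) - (τ x_{στ}) ⊗ 1)`;
then `split ε_σ = Pi.single σ 1`, so `split` is surjective, hence injective by
`finrank ℂ (ℂ ⊗[ℚ] K) = finrank ℚ K = #(K →+* ℂ)` (`Module.finrank_baseChange`, `NumberField.Embeddings.card`),
and the five clauses are read off after applying `split`.

The statement is spelled with the Mathlib expressions `Algebra.TensorProduct.includeRight x` (= Galois.lean's
`ratVec x`), `Algebra.TensorProduct.map (starRingEnd ℂ).toRatAlgHom (AlgHom.id ℚ K)` (= `conjKC K`) and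
`(starRingEnd ℂ).comp σ` (= `conjEmb σ`), so that Galois.lean's `exists_eps` closes by `exact Eps.exists_eps K`.

§8(d) (uses an L-value-free non-vanishing device): NO — pure algebra; nothing about the step (P) is claimed.
-/

namespace Summit.Ventures.HodgeRepro2.Tier7.Line2.Eps

open Summit.Ventures.HodgeRepro2.T6 (KC eigenLineK)
open scoped TensorProduct

noncomputable section

open scoped Classical

variable (K : Type*) [Field K] [NumberField K]

/-! ## 1. The evaluation map `split : ℂ ⊗_ℚ K → ∏_σ ℂ` -/

/-- the evaluation map `x ↦ (σ ↦ σ x)` as a ℚ-algebra hom `K → ∏_{σ : K →+* ℂ} ℂ` -/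
def evalK : K →ₐ[ℚ] ((K →+* ℂ) → ℂ) := AlgHom.pi fun σ => σ.toRatAlgHom

/-- `evalK x σ = σ x` -/
theorem evalK_apply (x : K) (σ : K →+* ℂ) : evalK K x σ = σ x := by
  simp [evalK]

/-- the ℂ-algebra map `split : ℂ ⊗[ℚ] K → ∏_σ ℂ`, `c ⊗ x ↦ (σ ↦ c · σ x)` (the base change of `evalK`) -/
def split : KC K →ₐ[ℂ] ((K →+* ℂ) → ℂ) := (evalK K).liftEquiv ℚ ℂ K ((K →+* ℂ) → ℂ)

/-- `split (c ⊗ x) σ = c · σ x` -/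
theorem split_tmul (c : ℂ) (x : K) (σ : K →+* ℂ) : split K (c ⊗ₜ x) σ = c * σ x := by
  simp [split, evalK_apply]

/-- `split (1 ⊗ x) σ = σ x` -/
theorem split_includeRight (x : K) (σ : K →+* ℂ) :
    split K (Algebra.TensorProduct.includeRight x : KC K) σ = σ x := by
  rw [Algebra.TensorProduct.includeRight_apply, split_tmul, one_mul]

/-- `split (c ⊗ 1) σ = c` -/
theorem split_algebraMap (c : ℂ) (σ : K →+* ℂ) : split K (algebraMap ℂ (KC K) c) σ = c := by
  rw [AlgHom.commutes]
  rfl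

/-! ## 2. Separating elements and the idempotents -/

omit [NumberField K] in
/-- two distinct embeddings are separated by some `x ∈ K` -/
theorem exists_sep {σ τ : K →+* ℂ} (h : σ ≠ τ) : ∃ x : K, σ x ≠ τ x := by
  by_contra hcon
  exact h (RingHom.ext fun x => by_contra fun hx => hcon ⟨x, hx⟩)

/-- a separating element `x(σ, τ)` with `σ x ≠ τ x` for `σ ≠ τ` (junk value `0` for `σ = τ`) -/
def sep (σ τ : K →+* ℂ) : K :=
  if h : σ = τ then 0 else (exists_sep K h).choose

omit [NumberField K] in
/-- `σ (sep σ τ) ≠ τ (sep σ τ)` for `σ ≠ τ` -/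
theorem sep_spec {σ τ : K →+* ℂ} (h : σ ≠ τ) : σ (sep K σ τ) ≠ τ (sep K σ τ) := by
  simp only [sep, dif_neg h]
  exact (exists_sep K h).choose_spec

/-- the σ-idempotent `ε_σ := ∏_{τ ≠ σ} (σ x_{στ} - τ x_{στ})⁻¹ • ((1 ⊗ x_{στ}) - (τ x_{στ}) ⊗ 1)` -/
def eps (σ : K →+* ℂ) : KC K :=
  ∏ τ ∈ Finset.univ.erase σ,
    (σ (sep K σ τ) - τ (sep K σ τ))⁻¹ •
      ((Algebra.TensorProduct.includeRight (sep K σ τ) : KC K) - algebraMap ℂ (KC K) (τ (sep K σ τ)))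

/-- `split ε_σ = Pi.single σ 1`: the factor at `τ = ρ` kills `ρ ≠ σ`, every factor is `1` at `ρ = σ` -/
theorem split_eps (σ : K →+* ℂ) : split K (eps K σ) = Pi.single σ 1 := by
  funext ρ
  simp only [eps, map_prod, map_smul, map_sub, Finset.prod_apply, Pi.smul_apply, Pi.sub_apply,
    split_includeRight, split_algebraMap, smul_eq_mul]
  by_cases hρ : ρ = σ
  · subst hρ
    rw [Pi.single_eq_same]
    apply Finset.prod_eq_one
    intro τ hτ
    have hne : ρ ≠ τ := (Finset.ne_of_mem_erase hτ).symm
    exact inv_mul_cancel₀ (sub_ne_zero.2 (sep_spec K hne))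
  · rw [Pi.single_eq_of_ne hρ]
    apply Finset.prod_eq_zero (Finset.mem_erase.2 ⟨hρ, Finset.mem_univ ρ⟩)
    simp

/-! ## 3. `split` is bijective -/

/-- `split` is surjective: `f = split (∑_σ f σ • ε_σ)` -/
theorem split_surjective : Function.Surjective (split K) := by
  intro f
  refine ⟨∑ σ, f σ • eps K σ, ?_⟩
  simp only [map_sum, map_smul, split_eps]
  funext ρ
  simp [Pi.single_apply]

/-- `finrank ℂ (ℂ ⊗[ℚ] K) = #(K →+* ℂ)` -/
theorem finrank_KC : Module.finrank ℂ (KC K) = Fintype.card (K →+* ℂ) := by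
  rw [Module.finrank_baseChange, NumberField.Embeddings.card]

/-- `split` is injective (surjective between spaces of the same finite dimension) -/
theorem split_injective : Function.Injective (split K) := by
  have h : Module.finrank ℂ (KC K) = Module.finrank ℂ ((K →+* ℂ) → ℂ) := by
    rw [finrank_KC, Module.finrank_fintype_fun_eq_card]
  have := (LinearMap.injective_iff_surjective_of_finrank_eq_finrank h
    (f := (split K).toLinearMap)).2 (split_surjective K)
  exact this

/-! ## 4. The five clauses -/

/-- `(1 ⊗ x) · ε_σ = σ(x) · ε_σ` -/
theorem includeRight_mul_eps (σ : K →+* ℂ) (x : K) :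
    (Algebra.TensorProduct.includeRight x : KC K) * eps K σ = σ x • eps K σ := by
  apply split_injective K
  rw [map_mul, map_smul, split_eps]
  funext ρ
  rw [Pi.mul_apply, Pi.smul_apply, split_includeRight, smul_eq_mul]
  by_cases hρ : ρ = σ
  · subst hρ
    rfl
  · rw [Pi.single_eq_of_ne hρ, mul_zero, mul_zero]

/-- `ε_σ ≠ 0` -/
theorem eps_ne_zero (σ : K →+* ℂ) : eps K σ ≠ 0 := by
  intro h
  have h1 := split_eps K σ
  rw [h, map_zero] at h1
  have h2 := congrFun h1 σ
  simp at h2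

/-- `∑_σ ε_σ = 1` -/
theorem sum_eps : ∑ σ : K →+* ℂ, eps K σ = 1 := by
  apply split_injective K
  rw [map_sum, map_one]
  simp only [split_eps]
  exact Finset.univ_sum_single (1 : (K →+* ℂ) → ℂ)

/-- every σ-eigenvector is a multiple of `ε_σ` (the eigenlines are lines) -/
theorem eq_smul_eps_of_mem_eigenLineK (σ : K →+* ℂ) (u : KC K) (hu : u ∈ eigenLineK K σ) :
    ∃ c : ℂ, u = c • eps K σ := by
  have hu' : ∀ x : K, (Algebra.TensorProduct.includeRight x : KC K) * u = σ x • u := hu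
  refine ⟨split K u σ, split_injective K ?_⟩
  rw [map_smul, split_eps]
  funext ρ
  by_cases hρ : ρ = σ
  · subst hρ
    rw [Pi.smul_apply, Pi.single_eq_same, smul_eq_mul, mul_one]
  · rw [Pi.smul_apply, Pi.single_eq_of_ne hρ, smul_zero]
    obtain ⟨x, hx⟩ := exists_sep K hρ
    have h1 := congrFun (congrArg (split K) (hu' x)) ρ
    simp only [map_mul, map_smul, split_includeRight, Pi.mul_apply, Pi.smul_apply, smul_eq_mul] at h1
    have h2 : (ρ x - σ x) * split K u ρ = 0 := by rw [sub_mul, h1, sub_self]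
    exact (mul_eq_zero.1 h2).resolve_left (sub_ne_zero.2 hx)

/-- `split` intertwines coefficient conjugation with the conjugate embedding:
`split (conj ⊗ id) u ρ = conj (split u (conj ∘ ρ))` -/
theorem split_conjKC (u : KC K) (ρ : K →+* ℂ) :
    split K (Algebra.TensorProduct.map (starRingEnd ℂ).toRatAlgHom (AlgHom.id ℚ K) u) ρ =
      starRingEnd ℂ (split K u ((starRingEnd ℂ).comp ρ)) := by
  induction u using TensorProduct.induction_on with
  | zero => simp
  | tmul c x =>
    rw [Algebra.TensorProduct.map_tmul, split_tmul, split_tmul]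
    simp
  | add u v hu hv =>
    simp only [map_add, Pi.add_apply, hu, hv]

omit [NumberField K] in
/-- `σ̄̄ = σ` -/
theorem conj_conj_comp (σ : K →+* ℂ) : (starRingEnd ℂ).comp ((starRingEnd ℂ).comp σ) = σ := by
  ext x
  simp

/-- `ε̄_σ = ε_{σ̄}` -/
theorem conjKC_eps (σ : K →+* ℂ) :
    Algebra.TensorProduct.map (starRingEnd ℂ).toRatAlgHom (AlgHom.id ℚ K) (eps K σ) =
      eps K ((starRingEnd ℂ).comp σ) := by
  apply split_injective K
  funext ρ
  rw [split_conjKC, split_eps, split_eps]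
  by_cases h : ρ = (starRingEnd ℂ).comp σ
  · subst h
    rw [conj_conj_comp, Pi.single_eq_same, Pi.single_eq_same, map_one]
  · have h' : (starRingEnd ℂ).comp ρ ≠ σ := by
      intro hc
      apply h
      rw [← hc, conj_conj_comp]
    rw [Pi.single_eq_of_ne h', Pi.single_eq_of_ne h, map_zero]

/-! ## 5. LEMMA 6 of Galois.lean, in Galois.lean's spelling -/

/-- LEMMA 6 (`exists_eps` of `Tier7/Line2/Galois.lean`): the splitting `K ⊗_ℚ ℂ ≅ ∏_σ ℂ` — a family of
σ-idempotents `eps` with `(1 ⊗ x) · ε_σ = σ(x) · ε_σ`, `ε_σ ≠ 0`, `∑_σ ε_σ = 1`, every σ-eigenvector a multiple of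
`ε_σ`, and `ε̄_σ = ε_{σ̄}`. The conjunction is Galois.lean's statement with `ratVec`, `conjKC`, `conjEmb` unfolded. -/
theorem exists_eps :
    ∃ eps : (K →+* ℂ) → KC K,
      (∀ (σ : K →+* ℂ) (x : K), (Algebra.TensorProduct.includeRight x : KC K) * eps σ = σ x • eps σ) ∧
      (∀ σ, eps σ ≠ 0) ∧
      (∑ σ : K →+* ℂ, eps σ = 1) ∧
      (∀ (σ : K →+* ℂ) (u : KC K), u ∈ eigenLineK K σ → ∃ c : ℂ, u = c • eps σ) ∧
      (∀ σ, Algebra.TensorProduct.map (starRingEnd ℂ).toRatAlgHom (AlgHom.id ℚ K) (eps σ) =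
        eps ((starRingEnd ℂ).comp σ)) :=
  ⟨eps K, includeRight_mul_eps K, eps_ne_zero K, sum_eps K, eq_smul_eps_of_mem_eigenLineK K, conjKC_eps K⟩

end

end Summit.Ventures.HodgeRepro2.Tier7.Line2.Eps
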